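import Summits.CriticalPhenomena.PercolationContinuityZ3.Theorems.PercNearOneGluingNoHeavyLowerTailAntitheticTwoStageMixed
import Summits.CriticalPhenomena.PercolationContinuityZ3.Theorems.PercNearOneGluingNoHeavyLowerTailAntitheticCutVertex
import HarnessLib

/-!
# `NoHeavyLowerTail` (stmt-CriticalPhenomena-4575) — antithetic cluster pairs: **THEOREM 2S** — the two-stage theorem WITHOUT (H1), graph side
# (HOME/THEOREM-2S.md, prim-hp-2 gen 60)

Support file (`--supports stmt-CriticalPhenomena-4575`, hull-port prover `prim-hp-2`, gen 60).  No definitions, no named facts, no sorries;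
standard axioms.  VERTEX version; setting of …AntitheticCutVertex / …AntitheticTwoStageGraph: two edge sets `E₁, E₂` on disjoint vertex sets
`U₁, U₂` glued at the source `s`, `y ∈ U₁`, `z ∈ U₂`, a bonus vertex `x`; `Xᵢ(ω) = openCluster (ω ∩ Eᵢ) s`, `Yᵢ(ω) = openCluster (ωᶜ ∩ Eᵢ) s`.

**THEOREM 2S** (`Antithetic.TwoStage.edge_change_nonneg`) = `TwoStage.change_nonneg` (THEOREM 2H) with hypothesis (H1) (side 1 nested-up at
`y`) REMOVED: assume only `sy ∈ E₁` and (H2) side 2 R-associated at `z` (every rooted cone, `TwoStage.Cone.R_associated`).  Then for all monotone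
`F, G` the CHANGE sum of deg-2 elimination over `E₁ ∪ E₂` is `≥ 0`; with `DegTwo.deg2_vertex_of_change` the vertex antithetic inequality at
`R = {x}` follows (`TwoStage.edge_vertex_sum_nonneg`).
Proof: CHANGE = TI + TII (rows `y ∉ X`, rows `y ∈ X ∧ z ∉ Y`); TI ≥ 0 on every graph (`Antithetic.termOne_nonneg`, block freezing, gen 56);
and `(cR/cB)·TI + TII ≥ 0` by grafting (`TwoStage.graft_double_sum`: the diagonal sum is `|Set (Sym2 V)|⁻¹` times the double sum over pairs of
colourings) and the abstract core `TwoStage.mixed_bound`; since `cR ≤ cB`, CHANGE = (1 − cR/cB)·TI + [(cR/cB)·TI + TII] ≥ 0.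
[cite: VandenbergHaggstromKahn2005, §1 p. 6 ("Harris' inequality"), §1 p. 3 (open cluster `C_s`)]
-/

noncomputable section

namespace Summit.CriticalPhenomena.PercolationContinuityZ3.Theorems

open Literature.Probability.Percolation
open scoped Classical

namespace Antithetic

namespace TwoStage

variable {V : Type*} [Fintype V]

/-- **Grafting** (as in `Cut.cutVertex_termTwo_nonneg` / `TwoStage.change_nonneg`): for disjoint edge sets, a function of the four side
clusters summed over PAIRS of colourings is `|Set (Sym2 V)|` times its diagonal sum. [this work] -/
theorem graft_double_sum (E₁ E₂ : Set (Sym2 V)) (hdis : Disjoint E₁ E₂) (s : V) (Φ : Set V → Set V → Set V → Set V → ℝ) :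
    ∑ ω₁ : Set (Sym2 V), ∑ ω₂ : Set (Sym2 V),
        Φ (openCluster (ω₁ ∩ E₁) s) (openCluster (ω₁ᶜ ∩ E₁) s) (openCluster (ω₂ ∩ E₂) s) (openCluster (ω₂ᶜ ∩ E₂) s) =
      (Fintype.card (Set (Sym2 V)) : ℝ) *
        ∑ ω : Set (Sym2 V), Φ (openCluster (ω ∩ E₁) s) (openCluster (ωᶜ ∩ E₁) s) (openCluster (ω ∩ E₂) s) (openCluster (ωᶜ ∩ E₂) s) := by
  let Ψ₂ : Set (Sym2 V) → Set (Sym2 V) → ℝ := fun ω₁ ω₂ =>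
    Φ (openCluster (ω₁ ∩ E₁) s) (openCluster (ω₁ᶜ ∩ E₁) s) (openCluster (ω₂ ∩ E₂) s) (openCluster (ω₂ᶜ ∩ E₂) s)
  have hdis' : ∀ e, e ∈ E₁ → e ∉ E₂ := fun e h1 h2 => Set.disjoint_left.1 hdis h1 h2
  let θ : Set (Sym2 V) × Set (Sym2 V) → Set (Sym2 V) × Set (Sym2 V) :=
    fun p => ((p.1 \ E₂) ∪ (p.2 ∩ E₂), (p.2 \ E₂) ∪ (p.1 ∩ E₂))
  have hθ : Function.Involutive θ := fun p => Cut.graft_graft E₂ p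
  have g1 : ∀ a b : Set (Sym2 V), ((a \ E₂) ∪ (b ∩ E₂)) ∩ E₁ = a ∩ E₁ := by
    intro a b; ext e
    simp only [Set.mem_inter_iff, Set.mem_union, Set.mem_sdiff]
    constructor
    · rintro ⟨h | h, he⟩
      · exact ⟨h.1, he⟩
      · exact absurd h.2 (hdis' e he)
    · rintro ⟨ha, he⟩; exact ⟨Or.inl ⟨ha, hdis' e he⟩, he⟩
  have g2 : ∀ a b : Set (Sym2 V), ((a \ E₂) ∪ (b ∩ E₂))ᶜ ∩ E₁ = aᶜ ∩ E₁ := by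
    intro a b; ext e
    simp only [Set.mem_inter_iff, Set.mem_compl_iff, Set.mem_union, Set.mem_sdiff, not_or, not_and, not_not]
    constructor
    · rintro ⟨⟨h1, _⟩, he⟩; exact ⟨fun ha => hdis' e he (h1 ha), he⟩
    · rintro ⟨ha, he⟩; exact ⟨⟨fun ha' => absurd ha' ha, fun _ he2 => absurd he2 (hdis' e he)⟩, he⟩
  have g3 : ∀ a b : Set (Sym2 V), ((a \ E₂) ∪ (b ∩ E₂)) ∩ E₂ = b ∩ E₂ := fun a b => (Cut.graft_inter_right a b).1
  have g4 : ∀ a b : Set (Sym2 V), ((a \ E₂) ∪ (b ∩ E₂))ᶜ ∩ E₂ = bᶜ ∩ E₂ := fun a b => (Cut.graft_inter_right a b).2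
  have hΨθ : ∀ p : Set (Sym2 V) × Set (Sym2 V), Ψ₂ p.1 p.2 = Ψ₂ (θ p).1 (θ p).1 := by
    intro p
    show Φ (openCluster (p.1 ∩ E₁) s) (openCluster (p.1ᶜ ∩ E₁) s) (openCluster (p.2 ∩ E₂) s) (openCluster (p.2ᶜ ∩ E₂) s) =
      Φ (openCluster (((p.1 \ E₂) ∪ (p.2 ∩ E₂)) ∩ E₁) s) (openCluster (((p.1 \ E₂) ∪ (p.2 ∩ E₂))ᶜ ∩ E₁) s)
        (openCluster (((p.1 \ E₂) ∪ (p.2 ∩ E₂)) ∩ E₂) s) (openCluster (((p.1 \ E₂) ∪ (p.2 ∩ E₂))ᶜ ∩ E₂) s)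
    rw [g1, g2, g3, g4]
  rw [← Fintype.sum_prod_type']
  rw [show ∑ p : Set (Sym2 V) × Set (Sym2 V), Ψ₂ p.1 p.2 = ∑ p : Set (Sym2 V) × Set (Sym2 V), Ψ₂ (θ p).1 (θ p).1 from
    Fintype.sum_congr _ _ hΨθ]
  rw [Fintype.sum_bijective θ hθ.bijective (fun p => Ψ₂ (θ p).1 (θ p).1) (fun q => Ψ₂ q.1 q.1) (fun p => rfl)]
  rw [Fintype.sum_prod_type, Finset.mul_sum]
  refine Finset.sum_congr rfl fun a _ => ?_
  show ∑ _b : Set (Sym2 V), Ψ₂ a a = _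
  rw [Finset.sum_const, Finset.card_univ, nsmul_eq_mul]

/-- **THEOREM 2S** (HOME/THEOREM-2S.md): CHANGE ≥ 0 over a cut composite with `sy ∈ E₁` and (H2) on the `z`-side — no hypothesis (H1).
[this work] -/
theorem edge_change_nonneg (E₁ E₂ : Set (Sym2 V)) (s y z x : V) (U₁ U₂ : Set V) (hU : Disjoint U₁ U₂) (hs₁ : s ∉ U₁)
    (hs₂ : s ∉ U₂) (hE₁ : ∀ e ∈ E₁, ∀ v ∈ e, v = s ∨ v ∈ U₁) (hE₂ : ∀ e ∈ E₂, ∀ v ∈ e, v = s ∨ v ∈ U₂)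
    (hdis : Disjoint E₁ E₂) (hy : y ∈ U₁) (hz : z ∈ U₂) (hsy : s(s, y) ∈ E₁)
    (hR : ∀ Φ₁ Φ₂ : Set V → Set V → ℝ,
      (∀ ⦃A A' B B' : Set V⦄, A ⊆ A' → B' ⊆ B → Φ₁ A B ≤ Φ₁ A' B') → (∀ ⦃A A' B B' : Set V⦄, A ⊆ A' → B' ⊆ B → Φ₂ A B ≤ Φ₂ A' B') →
      (∑ T ∈ Finset.univ.filter (fun T : Set (Sym2 V) => z ∉ openCluster (Tᶜ ∩ E₂) s),
          Φ₁ (openCluster (T ∩ E₂) s) (openCluster (Tᶜ ∩ E₂) s)) *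
        (∑ T ∈ Finset.univ.filter (fun T : Set (Sym2 V) => z ∉ openCluster (Tᶜ ∩ E₂) s),
          Φ₂ (openCluster (T ∩ E₂) s) (openCluster (Tᶜ ∩ E₂) s)) ≤
      ((Finset.univ.filter fun T : Set (Sym2 V) => z ∉ openCluster (Tᶜ ∩ E₂) s).card : ℝ) *
        ∑ T ∈ Finset.univ.filter (fun T : Set (Sym2 V) => z ∉ openCluster (Tᶜ ∩ E₂) s),
          Φ₁ (openCluster (T ∩ E₂) s) (openCluster (Tᶜ ∩ E₂) s) * Φ₂ (openCluster (T ∩ E₂) s) (openCluster (Tᶜ ∩ E₂) s))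
    {F G : Set V → ℝ} (hF : Monotone F) (hG : Monotone G) :
    0 ≤ ∑ ω ∈ Finset.univ.filter (fun ω : Set (Sym2 V) =>
        ¬ ((openGraph (ω ∩ (E₁ ∪ E₂))).Reachable s y ∧ (openGraph (ωᶜ ∩ (E₁ ∪ E₂))).Reachable s z)),
      (F (openCluster (ω ∩ (E₁ ∪ E₂)) s ∪ {v | v ∈ ({x} : Set V) ∧ y ∈ openCluster (ω ∩ (E₁ ∪ E₂)) s}) -
          F (openCluster (ωᶜ ∩ (E₁ ∪ E₂)) s ∪ {v | v ∈ ({x} : Set V) ∧ z ∈ openCluster (ωᶜ ∩ (E₁ ∪ E₂)) s})) *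
        (G (openCluster (ω ∩ (E₁ ∪ E₂)) s ∪ {v | v ∈ ({x} : Set V) ∧ y ∈ openCluster (ω ∩ (E₁ ∪ E₂)) s}) -
          G (openCluster (ωᶜ ∩ (E₁ ∪ E₂)) s ∪ {v | v ∈ ({x} : Set V) ∧ z ∈ openCluster (ωᶜ ∩ (E₁ ∪ E₂)) s})) := by
  -- notation
  let X₁ : Set (Sym2 V) → Set V := fun ω => openCluster (ω ∩ E₁) s
  let Y₁ : Set (Sym2 V) → Set V := fun ω => openCluster (ωᶜ ∩ E₁) s
  let X₂ : Set (Sym2 V) → Set V := fun ω => openCluster (ω ∩ E₂) s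
  let Y₂ : Set (Sym2 V) → Set V := fun ω => openCluster (ωᶜ ∩ E₂) s
  let h₁ : Set V → Set V → ℝ := fun P Q => F P - F Q
  let h₂ : Set V → Set V → ℝ := fun P Q => G P - G Q
  have hh₁ : ∀ ⦃A A' B B' : Set V⦄, A ⊆ A' → B' ⊆ B → h₁ A B ≤ h₁ A' B' := fun A A' B B' hA hB => sub_le_sub (hF hA) (hF hB)
  have hh₂ : ∀ ⦃A A' B B' : Set V⦄, A ⊆ A' → B' ⊆ B → h₂ A B ≤ h₂ A' B' := fun A A' B B' hA hB => sub_le_sub (hG hA) (hG hB)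
  have hodd₁ : ∀ A B, h₁ B A = -h₁ A B := fun A B => by show F B - F A = -(F A - F B); ring
  have hodd₂ : ∀ A B, h₂ B A = -h₂ A B := fun A B => by show G B - G A = -(G A - G B); ring
  -- the CHANGE summand, and the term-wise pair functional
  let PF : Set V → Set V → Set V → Set V → ℝ := fun A B C D =>
    h₁ (A ∪ C ∪ {v | v ∈ ({x} : Set V) ∧ y ∈ A}) (B ∪ D ∪ {v | v ∈ ({x} : Set V) ∧ z ∈ D}) *
      h₂ (A ∪ C ∪ {v | v ∈ ({x} : Set V) ∧ y ∈ A}) (B ∪ D ∪ {v | v ∈ ({x} : Set V) ∧ z ∈ D})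
  let Ψ : Set (Sym2 V) → ℝ := fun ω =>
    h₁ (openCluster (ω ∩ (E₁ ∪ E₂)) s ∪ {v | v ∈ ({x} : Set V) ∧ y ∈ openCluster (ω ∩ (E₁ ∪ E₂)) s})
        (openCluster (ωᶜ ∩ (E₁ ∪ E₂)) s ∪ {v | v ∈ ({x} : Set V) ∧ z ∈ openCluster (ωᶜ ∩ (E₁ ∪ E₂)) s}) *
      h₂ (openCluster (ω ∩ (E₁ ∪ E₂)) s ∪ {v | v ∈ ({x} : Set V) ∧ y ∈ openCluster (ω ∩ (E₁ ∪ E₂)) s})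
        (openCluster (ωᶜ ∩ (E₁ ∪ E₂)) s ∪ {v | v ∈ ({x} : Set V) ∧ z ∈ openCluster (ωᶜ ∩ (E₁ ∪ E₂)) s})
  let Ry : Set (Sym2 V) → Prop := fun ω => (openGraph (ω ∩ (E₁ ∪ E₂))).Reachable s y
  let Rz : Set (Sym2 V) → Prop := fun ω => (openGraph (ωᶜ ∩ (E₁ ∪ E₂))).Reachable s z
  show 0 ≤ ∑ ω ∈ Finset.univ.filter (fun ω => ¬ (Ry ω ∧ Rz ω)), Ψ ω
  -- cut-vertex facts
  have e1 : ∀ ω, openCluster (ω ∩ (E₁ ∪ E₂)) s = X₁ ω ∪ X₂ ω := fun ω => Cut.cluster_union hU hs₁ hs₂ hE₁ hE₂ ω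
  have e2 : ∀ ω, openCluster (ωᶜ ∩ (E₁ ∪ E₂)) s = Y₁ ω ∪ Y₂ ω := fun ω => Cut.cluster_union hU hs₁ hs₂ hE₁ hE₂ ωᶜ
  have c1 : ∀ ω, Ry ω ↔ y ∈ X₁ ω := fun ω => by
    change y ∈ openCluster (ω ∩ (E₁ ∪ E₂)) s ↔ _
    rw [e1, Set.mem_union]
    exact ⟨fun h => h.resolve_right (Cut.not_mem_cluster_other hU hs₁ hE₂ hy ω), Or.inl⟩
  have c2 : ∀ ω, Rz ω ↔ z ∈ Y₂ ω := fun ω => by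
    change z ∈ openCluster (ωᶜ ∩ (E₁ ∪ E₂)) s ↔ _
    rw [e2, Set.mem_union]
    exact ⟨fun h => h.resolve_left (Cut.not_mem_cluster_other hU.symm hs₂ hE₁ hz ωᶜ), Or.inr⟩
  have hdiagP : ∀ ω, PF (X₁ ω) (Y₁ ω) (X₂ ω) (Y₂ ω) = Ψ ω := by
    intro ω
    have c1' : (y ∈ openCluster (ω ∩ (E₁ ∪ E₂)) s) = (y ∈ X₁ ω) := propext (c1 ω)
    have c2' : (z ∈ openCluster (ωᶜ ∩ (E₁ ∪ E₂)) s) = (z ∈ Y₂ ω) := propext (c2 ω)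
    have sx1 : {v | v ∈ ({x} : Set V) ∧ y ∈ openCluster (ω ∩ (E₁ ∪ E₂)) s} = {v | v ∈ ({x} : Set V) ∧ y ∈ X₁ ω} := by rw [c1']
    have sx2 : {v | v ∈ ({x} : Set V) ∧ z ∈ openCluster (ωᶜ ∩ (E₁ ∪ E₂)) s} = {v | v ∈ ({x} : Set V) ∧ z ∈ Y₂ ω} := by rw [c2']
    show _ = h₁ (openCluster (ω ∩ (E₁ ∪ E₂)) s ∪ {v | v ∈ ({x} : Set V) ∧ y ∈ openCluster (ω ∩ (E₁ ∪ E₂)) s})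
        (openCluster (ωᶜ ∩ (E₁ ∪ E₂)) s ∪ {v | v ∈ ({x} : Set V) ∧ z ∈ openCluster (ωᶜ ∩ (E₁ ∪ E₂)) s}) *
      h₂ (openCluster (ω ∩ (E₁ ∪ E₂)) s ∪ {v | v ∈ ({x} : Set V) ∧ y ∈ openCluster (ω ∩ (E₁ ∪ E₂)) s})
        (openCluster (ωᶜ ∩ (E₁ ∪ E₂)) s ∪ {v | v ∈ ({x} : Set V) ∧ z ∈ openCluster (ωᶜ ∩ (E₁ ∪ E₂)) s})
    rw [sx1, sx2, e1, e2]
  -- split CHANGE = TI + TII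
  let SI : ℝ := ∑ ω ∈ Finset.univ.filter (fun ω => ¬ Ry ω), Ψ ω
  let SII : ℝ := ∑ ω ∈ Finset.univ.filter (fun ω => Ry ω ∧ ¬ Rz ω), Ψ ω
  have hsplit : ∑ ω ∈ Finset.univ.filter (fun ω => ¬ (Ry ω ∧ Rz ω)), Ψ ω = SI + SII := by
    show _ = ∑ ω ∈ Finset.univ.filter (fun ω => ¬ Ry ω), Ψ ω + ∑ ω ∈ Finset.univ.filter (fun ω => Ry ω ∧ ¬ Rz ω), Ψ ω
    rw [Finset.sum_filter, Finset.sum_filter, Finset.sum_filter, ← Finset.sum_add_distrib]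
    refine Finset.sum_congr rfl fun ω _ => ?_
    by_cases hy' : Ry ω
    · by_cases hz' : Rz ω
      · rw [if_neg (not_not.2 ⟨hy', hz'⟩), if_neg (not_not.2 hy'), if_neg (fun h => h.2 hz')]; ring
      · rw [if_pos (fun h => hz' h.2), if_neg (not_not.2 hy'), if_pos ⟨hy', hz'⟩]; ring
    · rw [if_pos (fun h => hy' h.1), if_pos hy', if_neg (fun h => hy' h.1)]; ring
  -- TERM I ≥ 0 on every graph (block freezing)
  have hI : 0 ≤ SI := by
    have hT := termOne_nonneg (E₁ ∪ E₂) s y z ({x} : Set V) hF hG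
    have hre : SI = ∑ ω ∈ Finset.univ.filter (fun ω : Set (Sym2 V) => ¬ (openGraph (ω ∩ (E₁ ∪ E₂))).Reachable s y),
        (F (openCluster (ω ∩ (E₁ ∪ E₂)) s) - F (openCluster (ωᶜ ∩ (E₁ ∪ E₂)) s ∪ {v | v ∈ ({x} : Set V) ∧ z ∈ openCluster (ωᶜ ∩ (E₁ ∪ E₂)) s})) *
          (G (openCluster (ω ∩ (E₁ ∪ E₂)) s) - G (openCluster (ωᶜ ∩ (E₁ ∪ E₂)) s ∪ {v | v ∈ ({x} : Set V) ∧ z ∈ openCluster (ωᶜ ∩ (E₁ ∪ E₂)) s})) := by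
      refine Finset.sum_congr rfl fun ω hω => ?_
      have hy' : y ∉ openCluster (ω ∩ (E₁ ∪ E₂)) s := (Finset.mem_filter.1 hω).2
      have hempty : {v | v ∈ ({x} : Set V) ∧ y ∈ openCluster (ω ∩ (E₁ ∪ E₂)) s} = ∅ := by
        ext v; simp only [Set.mem_setOf_eq, Set.mem_empty_iff_false, iff_false, not_and]; exact fun _ => hy'
      show h₁ _ _ * h₂ _ _ = _
      simp only [h₁, h₂, hempty, Set.union_empty]
    rw [hre]; exact hT
  -- the constants
  set U : Finset (Set (Sym2 V)) := Finset.univ.filter (fun T : Set (Sym2 V) => z ∉ Y₂ T) with hUdef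
  have hzs : z ≠ s := fun h => hs₂ (h ▸ hz)
  have hUne : (Set.univ : Set (Sym2 V)) ∈ U := by
    rw [hUdef, Finset.mem_filter]
    refine ⟨Finset.mem_univ _, ?_⟩
    show z ∉ openCluster ((Set.univ : Set (Sym2 V))ᶜ ∩ E₂) s
    rw [Set.compl_univ, Set.empty_inter]
    show ¬ (openGraph (∅ : Set (Sym2 V))).Reachable s z
    intro h
    have : (openGraph (∅ : Set (Sym2 V))) = ⊥ := by
      ext a b; simp [openGraph_adj]
    rw [this, SimpleGraph.reachable_bot] at h
    exact hzs h.symm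
  have hcRnat : 0 < U.card := Finset.card_pos.2 ⟨_, hUne⟩
  set cR : ℝ := (U.card : ℝ) with hcRdef
  set cB : ℝ := (Fintype.card (Set (Sym2 V)) : ℝ) with hcBdef
  have hcRpos : 0 < cR := by rw [hcRdef]; exact_mod_cast hcRnat
  have hcBpos : 0 < cB := by rw [hcBdef]; exact_mod_cast Fintype.card_pos
  have hcRB : cR ≤ cB := by rw [hcRdef, hcBdef]; exact_mod_cast (Finset.card_le_univ U)
  -- the key inequality: (cR/cB)·TI + TII ≥ 0 — grafting + the abstract mixed bound
  have hkey : 0 ≤ cR / cB * SI + SII := by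
    -- the pair functional
    let Φ : Set V → Set V → Set V → Set V → ℝ := fun A B C D =>
      cR / cB * (if y ∉ A then PF A B C D else 0) + (if y ∈ A ∧ z ∉ D then PF A B C D else 0)
    have hX₂mono : Monotone X₂ := fun T T' h => Freeze.openCluster_mono (Set.inter_subset_inter_left E₂ h) s
    have hY₂anti : Antitone Y₂ := fun T T' h => Freeze.openCluster_mono (Set.inter_subset_inter_left E₂ (Set.compl_subset_compl.2 h)) s
    have hXY : ∀ T, Y₂ T = X₂ Tᶜ := fun T => rfl
    -- (a) the double sum is nonnegative (mixed_bound)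
    have hMB := mixed_bound X₂ Y₂ hX₂mono hY₂anti hXY x z E₁ s y hsy hR hcRnat hh₁ hh₂ hodd₁ hodd₂
    rw [← hUdef, ← hcBdef, ← hcRdef] at hMB
    have hrows : ∀ ω₁ : Set (Sym2 V), ∑ ω₂ : Set (Sym2 V), Φ (X₁ ω₁) (Y₁ ω₁) (X₂ ω₂) (Y₂ ω₂) =
        cR / cB * (if y ∉ X₁ ω₁ then
            ∑ T : Set (Sym2 V), h₁ (X₁ ω₁ ∪ X₂ T) (Y₁ ω₁ ∪ Y₂ T ∪ {v | v ∈ ({x} : Set V) ∧ z ∈ Y₂ T}) *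
              h₂ (X₁ ω₁ ∪ X₂ T) (Y₁ ω₁ ∪ Y₂ T ∪ {v | v ∈ ({x} : Set V) ∧ z ∈ Y₂ T}) else 0) +
          (if y ∈ X₁ ω₁ then ∑ T ∈ U, h₁ (X₁ ω₁ ∪ X₂ T ∪ {x}) (Y₁ ω₁ ∪ Y₂ T) * h₂ (X₁ ω₁ ∪ X₂ T ∪ {x}) (Y₁ ω₁ ∪ Y₂ T) else 0) := by
      intro ω₁
      show ∑ ω₂ : Set (Sym2 V), (cR / cB * (if y ∉ X₁ ω₁ then PF (X₁ ω₁) (Y₁ ω₁) (X₂ ω₂) (Y₂ ω₂) else 0) +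
          (if y ∈ X₁ ω₁ ∧ z ∉ Y₂ ω₂ then PF (X₁ ω₁) (Y₁ ω₁) (X₂ ω₂) (Y₂ ω₂) else 0)) = _
      rw [Finset.sum_add_distrib, ← Finset.mul_sum]
      by_cases hyx : y ∈ X₁ ω₁
      · have s1 : {v | v ∈ ({x} : Set V) ∧ y ∈ X₁ ω₁} = {x} := by ext v; simp [hyx]
        rw [if_neg (not_not.2 hyx), if_pos hyx, Finset.sum_filter]
        congr 1
        · rw [Finset.sum_eq_zero fun ω₂ _ => if_neg (not_not.2 hyx), mul_zero]
        · refine Finset.sum_congr rfl fun ω₂ _ => ?_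
          by_cases hz' : z ∉ Y₂ ω₂
          · have s2 : Y₁ ω₁ ∪ Y₂ ω₂ ∪ {v | v ∈ ({x} : Set V) ∧ z ∈ Y₂ ω₂} = Y₁ ω₁ ∪ Y₂ ω₂ := by
              ext v; simp only [Set.mem_union, Set.mem_setOf_eq]; tauto
            rw [if_pos ⟨hyx, hz'⟩, if_pos hz']
            show h₁ (X₁ ω₁ ∪ X₂ ω₂ ∪ {v | v ∈ ({x} : Set V) ∧ y ∈ X₁ ω₁}) (Y₁ ω₁ ∪ Y₂ ω₂ ∪ {v | v ∈ ({x} : Set V) ∧ z ∈ Y₂ ω₂}) *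
                h₂ (X₁ ω₁ ∪ X₂ ω₂ ∪ {v | v ∈ ({x} : Set V) ∧ y ∈ X₁ ω₁}) (Y₁ ω₁ ∪ Y₂ ω₂ ∪ {v | v ∈ ({x} : Set V) ∧ z ∈ Y₂ ω₂}) = _
            rw [s1, s2]
          · rw [if_neg (fun h => hz' h.2), if_neg hz']
      · have s1 : {v | v ∈ ({x} : Set V) ∧ y ∈ X₁ ω₁} = ∅ := by ext v; simp [hyx]
        rw [if_pos hyx, if_neg hyx]
        congr 1
        · congr 1
          refine Finset.sum_congr rfl fun ω₂ _ => ?_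
          rw [if_pos hyx]
          show h₁ (X₁ ω₁ ∪ X₂ ω₂ ∪ {v | v ∈ ({x} : Set V) ∧ y ∈ X₁ ω₁}) (Y₁ ω₁ ∪ Y₂ ω₂ ∪ {v | v ∈ ({x} : Set V) ∧ z ∈ Y₂ ω₂}) *
              h₂ (X₁ ω₁ ∪ X₂ ω₂ ∪ {v | v ∈ ({x} : Set V) ∧ y ∈ X₁ ω₁}) (Y₁ ω₁ ∪ Y₂ ω₂ ∪ {v | v ∈ ({x} : Set V) ∧ z ∈ Y₂ ω₂}) = _
          rw [s1, Set.union_empty]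
        · exact Finset.sum_eq_zero fun ω₂ _ => if_neg (fun h => hyx h.1)
    have hdbl : 0 ≤ ∑ ω₁ : Set (Sym2 V), ∑ ω₂ : Set (Sym2 V), Φ (X₁ ω₁) (Y₁ ω₁) (X₂ ω₂) (Y₂ ω₂) := by
      simp_rw [hrows]; exact hMB
    -- (b) grafting: the double sum is `cB` times the diagonal, and the diagonal is `(cR/cB)·SI + SII`
    have hgraft := graft_double_sum E₁ E₂ hdis s Φ
    have hdiag : ∑ ω : Set (Sym2 V), Φ (X₁ ω) (Y₁ ω) (X₂ ω) (Y₂ ω) = cR / cB * SI + SII := by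
      show ∑ ω : Set (Sym2 V), (cR / cB * (if y ∉ X₁ ω then PF (X₁ ω) (Y₁ ω) (X₂ ω) (Y₂ ω) else 0) +
          (if y ∈ X₁ ω ∧ z ∉ Y₂ ω then PF (X₁ ω) (Y₁ ω) (X₂ ω) (Y₂ ω) else 0)) =
        cR / cB * ∑ ω ∈ Finset.univ.filter (fun ω => ¬ Ry ω), Ψ ω + ∑ ω ∈ Finset.univ.filter (fun ω => Ry ω ∧ ¬ Rz ω), Ψ ω
      rw [Finset.sum_add_distrib, ← Finset.mul_sum, Finset.sum_filter, Finset.sum_filter]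
      congr 1
      · congr 1
        refine Finset.sum_congr rfl fun ω _ => ?_
        rw [hdiagP]
        by_cases h : Ry ω
        · rw [if_neg (not_not.2 ((c1 ω).1 h)), if_neg (not_not.2 h)]
        · rw [if_pos (fun h' => h ((c1 ω).2 h')), if_pos h]
      · refine Finset.sum_congr rfl fun ω _ => ?_
        rw [hdiagP]
        by_cases h : Ry ω ∧ ¬ Rz ω
        · rw [if_pos (⟨(c1 ω).1 h.1, fun h' => h.2 ((c2 ω).2 h')⟩ : y ∈ X₁ ω ∧ z ∉ Y₂ ω), if_pos h]
        · rw [if_neg (fun h' => h ⟨(c1 ω).2 h'.1, fun h'' => h'.2 ((c2 ω).1 h'')⟩), if_neg h]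
    have h3 : 0 ≤ cB * (cR / cB * SI + SII) := by
      rw [← hdiag, hcBdef, ← hgraft]; exact hdbl
    exact (mul_nonneg_iff_of_pos_left hcBpos).1 h3
  -- conclude: CHANGE = (1 - cR/cB)·TI + [(cR/cB)·TI + TII]
  rw [hsplit]
  have hr : cR / cB ≤ 1 := (div_le_one hcBpos).2 hcRB
  have hprod : 0 ≤ (1 - cR / cB) * SI := mul_nonneg (sub_nonneg.2 hr) hI
  nlinarith [hprod, hkey]

section Vertex

variable {E : Set (Sym2 V)} {s x y z : V} (hxs : x ≠ s) (hxy : x ≠ y) (hxz : x ≠ z) (hyz : y ≠ z)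
  (he : s(x, y) ∈ E) (hf : s(x, z) ∈ E) (hdeg : ∀ h ∈ E, x ∈ h → h = s(x, y) ∨ h = s(x, z)) (hg : s(y, z) ∉ E)
include hxs hxy hxz hyz he hf hdeg hg

/-- **THEOREM 2S, vertex form**: `x` of degree 2 with neighbours `y ≠ z` (`yz ∉ E`); `E ∖ {xy, xz} = E₁ ∪ E₂` glued at `s` only, sides on
disjoint vertex sets `U₁ ∋ y`, `U₂ ∋ z`; `sy ∈ E₁`; side 2 R-associated at `z`.  Then the vertex antithetic sum over `D({x})` is nonnegative for
all monotone `F, G` — `TwoStage.vertex_sum_nonneg` without the nestedness hypothesis. [this work] -/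
theorem edge_vertex_sum_nonneg (E₁ E₂ : Set (Sym2 V)) (U₁ U₂ : Set V) (hE' : E \ {s(x, y), s(x, z)} = E₁ ∪ E₂)
    (hU : Disjoint U₁ U₂) (hs₁ : s ∉ U₁) (hs₂ : s ∉ U₂) (hE₁ : ∀ e ∈ E₁, ∀ v ∈ e, v = s ∨ v ∈ U₁)
    (hE₂ : ∀ e ∈ E₂, ∀ v ∈ e, v = s ∨ v ∈ U₂) (hdis : Disjoint E₁ E₂) (hyU : y ∈ U₁) (hzU : z ∈ U₂) (hsy : s(s, y) ∈ E₁)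
    (hR : ∀ Φ₁ Φ₂ : Set V → Set V → ℝ,
      (∀ ⦃A A' B B' : Set V⦄, A ⊆ A' → B' ⊆ B → Φ₁ A B ≤ Φ₁ A' B') → (∀ ⦃A A' B B' : Set V⦄, A ⊆ A' → B' ⊆ B → Φ₂ A B ≤ Φ₂ A' B') →
      (∑ T ∈ Finset.univ.filter (fun T : Set (Sym2 V) => z ∉ openCluster (Tᶜ ∩ E₂) s),
          Φ₁ (openCluster (T ∩ E₂) s) (openCluster (Tᶜ ∩ E₂) s)) *
        (∑ T ∈ Finset.univ.filter (fun T : Set (Sym2 V) => z ∉ openCluster (Tᶜ ∩ E₂) s),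
          Φ₂ (openCluster (T ∩ E₂) s) (openCluster (Tᶜ ∩ E₂) s)) ≤
      ((Finset.univ.filter fun T : Set (Sym2 V) => z ∉ openCluster (Tᶜ ∩ E₂) s).card : ℝ) *
        ∑ T ∈ Finset.univ.filter (fun T : Set (Sym2 V) => z ∉ openCluster (Tᶜ ∩ E₂) s),
          Φ₁ (openCluster (T ∩ E₂) s) (openCluster (Tᶜ ∩ E₂) s) * Φ₂ (openCluster (T ∩ E₂) s) (openCluster (Tᶜ ∩ E₂) s))
    {F G : Set V → ℝ} (hF : Monotone F) (hG : Monotone G) :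
    0 ≤ ∑ ω ∈ Finset.univ.filter (fun ω : Set (Sym2 V) =>
        ¬ ((openGraph (ω ∩ E)).Reachable s x ∧ (openGraph (ωᶜ ∩ E)).Reachable s x)),
      (F (openCluster (ω ∩ E) s) - F (openCluster (ωᶜ ∩ E) s)) * (G (openCluster (ω ∩ E) s) - G (openCluster (ωᶜ ∩ E) s)) := by
  refine DegTwo.deg2_vertex_of_change hxs hxy hxz hyz he hf hdeg hg hF hG ?_
  rw [hE']
  exact edge_change_nonneg E₁ E₂ s y z x U₁ U₂ hU hs₁ hs₂ hE₁ hE₂ hdis hyU hzU hsy hR hF hG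

end Vertex

end TwoStage

end Antithetic

end Summit.CriticalPhenomena.PercolationContinuityZ3.Theorems
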